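import Mathlib
import HarnessLib
import Summits.MatrixMultiplication.MatrixMultiplication.Theses.ProbeRankThreshold
import Literature.Computability.AlgebraicComplexity.MatrixMultiplicationExponent
import Literature.Computability.AlgebraicComplexity.MignonRessayreBound

/-!
# `ProbeRankThreshold.XRankLaw` (stmt-MatrixMultiplication-6603) — proved

The X-RANK LAW of route `ProbeRankThreshold`: for every decomposition of the matrix multiplication
tensor `⟨k,m,n⟩ = ∑_{i<r} w_i ⊗ u_i ⊗ v_i` over `ℂ` (slots: `w_i` on the `Z`-positions `(κ,ν)`,
`u_i` on the `X`-positions `(κ,μ)`, `v_i` on the `Y`-positions `(μ,ν)`), the X-probes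
`U_i = (u_i read as a k × m matrix)` satisfy `∑_i rank U_i ≥ k·m·n`.

Proof (one flattening of the 6-leg tensor).  Flatten `t (a₁,a₂) (b₁,b₂) (c₁,c₂)` into the
matrix with rows `(b₁,(c₁,c₂))` and columns `(b₂,(a₁,a₂))`.
* The flattening of `⟨k,m,n⟩` has entry `1` exactly at column `(c₁,(b₁,c₂))` of row
  `(b₁,(c₁,c₂))`, i.e. it is the identity matrix with rows permuted along the bijection
  `(b₁,(c₁,c₂)) ↦ (c₁,(b₁,c₂))`; its rank is `k·m·n` (`Matrix.rank_submatrix`, `Matrix.rank_one`).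
* The flattening of a triad `w ⊗ u ⊗ v` is the product `L * U * R` with
  `L (b₁,c) b = [b₁ = b]·v c` and `R b (b₂,a) = [b = b₂]·w a`, so its rank is `≤ rank U`
  (`Matrix.rank_mul_le_left`, `Matrix.rank_mul_le_right`).
* Flattening is additive and rank is subadditive
  (`Literature.Computability.AlgebraicComplexity.rank_sum_le`).
-/

namespace Summit.MatrixMultiplication.MatrixMultiplication.Theorems

open scoped BigOperators
open Literature.Computability.AlgebraicComplexity

/-- The flattening rows `(b₁,(c₁,c₂))` | columns `(b₂,(a₁,a₂))` of the matrix multiplication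
tensor `⟨k,m,n⟩` is a permuted identity matrix, hence has rank `k·m·n`. [folklore] -/
theorem rank_xFlattening_matMulTensor (k m n : ℕ) :
    (Matrix.of fun (ρ : Fin k × (Fin m × Fin n)) (c : Fin m × (Fin k × Fin n)) =>
        matMulTensor ℂ k m n c.2 (ρ.1, c.1) ρ.2).rank = k * m * n := by
  let σ : (Fin k × (Fin m × Fin n)) ≃ (Fin m × (Fin k × Fin n)) :=
    { toFun := fun ρ => (ρ.2.1, (ρ.1, ρ.2.2))
      invFun := fun c => (c.2.1, (c.1, c.2.2))
      left_inv := fun _ => rfl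
      right_inv := fun _ => rfl }
  have hflat : (Matrix.of fun (ρ : Fin k × (Fin m × Fin n)) (c : Fin m × (Fin k × Fin n)) =>
        matMulTensor ℂ k m n c.2 (ρ.1, c.1) ρ.2)
      = (1 : Matrix (Fin m × (Fin k × Fin n)) (Fin m × (Fin k × Fin n)) ℂ).submatrix
          σ (Equiv.refl _) := by
    ext ⟨b₁, c₁, c₂⟩ ⟨b₂, a₁, a₂⟩
    simp only [Matrix.of_apply, Matrix.submatrix_apply, Equiv.refl_apply, Matrix.one_apply,
      matMulTensor, Equiv.coe_fn_mk, Prod.mk.injEq, σ]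
    split_ifs with h h'
    · rfl
    · exact absurd ⟨h.2.1.symm, h.1.symm, h.2.2.symm⟩ h'
    · rename_i h'
      exact absurd ⟨h'.2.1.symm, h'.1.symm, h'.2.2.symm⟩ h
    · rfl
  rw [hflat, Matrix.rank_submatrix, Matrix.rank_one]
  simp only [Fintype.card_prod, Fintype.card_fin]
  ring

/-- The same flattening of a triad `w ⊗ u ⊗ v` factors as `L * U * R` through the X-probe
`U = (u read as a k × m matrix)`. [folklore] -/
theorem xFlattening_triad {k m n : ℕ} (w : Fin k × Fin n → ℂ) (u : Fin k × Fin m → ℂ)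
    (v : Fin m × Fin n → ℂ) :
    (Matrix.of fun (ρ : Fin k × (Fin m × Fin n)) (c : Fin m × (Fin k × Fin n)) =>
        triad w u v c.2 (ρ.1, c.1) ρ.2)
      = (Matrix.of fun (ρ : Fin k × (Fin m × Fin n)) (b : Fin k) => if ρ.1 = b then v ρ.2 else 0)
        * (Matrix.of fun p q => u (p, q))
        * (Matrix.of fun (b : Fin m) (c : Fin m × (Fin k × Fin n)) =>
            if b = c.1 then w c.2 else 0) := by
  ext ρ c
  simp only [Matrix.mul_apply, Matrix.of_apply, triad_apply, ite_mul, zero_mul, mul_ite,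
    mul_zero, Finset.sum_ite_eq, Finset.sum_ite_eq', Finset.mem_univ, if_true]
  ring

/-- Rank of the flattening of a triad is at most the rank of its X-probe. [folklore] -/
theorem rank_xFlattening_triad_le {k m n : ℕ} (w : Fin k × Fin n → ℂ) (u : Fin k × Fin m → ℂ)
    (v : Fin m × Fin n → ℂ) :
    (Matrix.of fun (ρ : Fin k × (Fin m × Fin n)) (c : Fin m × (Fin k × Fin n)) =>
        triad w u v c.2 (ρ.1, c.1) ρ.2).rank ≤ (Matrix.of fun p q => u (p, q)).rank := by
  rw [xFlattening_triad]
  exact (Matrix.rank_mul_le_left _ _).trans (Matrix.rank_mul_le_right _ _)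

/-- **X-rank law** (item `stmt-MatrixMultiplication-6603`, route `ProbeRankThreshold`): for
every decomposition `⟨k,m,n⟩ = ∑_{i<r} w_i ⊗ u_i ⊗ v_i` over `ℂ`, `k·m·n ≤ ∑_i rank U_i` where
`U_i` is `u_i` read as a `k × m` matrix.  One flattening of the 6-leg tensor (rows
`(b₁,(c₁,c₂))`, columns `(b₂,(a₁,a₂))`): `⟨k,m,n⟩` becomes a permutation matrix of rank
`k·m·n`, the `i`-th triad becomes `L_i * U_i * R_i` of rank `≤ rank U_i`, and rank is
subadditive. [folklore] -/
theorem xRankLaw_proof :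
    Summit.MatrixMultiplication.MatrixMultiplication.Theses.ProbeRankThreshold.XRankLaw := by
  unfold Summit.MatrixMultiplication.MatrixMultiplication.Theses.ProbeRankThreshold.XRankLaw
  intro k m n r w u v hdec
  have hflat : (Matrix.of fun (ρ : Fin k × (Fin m × Fin n)) (c : Fin m × (Fin k × Fin n)) =>
        matMulTensor ℂ k m n c.2 (ρ.1, c.1) ρ.2)
      = ∑ i, (Matrix.of fun (ρ : Fin k × (Fin m × Fin n)) (c : Fin m × (Fin k × Fin n)) =>
          triad (w i) (u i) (v i) c.2 (ρ.1, c.1) ρ.2) := by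
    ext ρ c
    rw [hdec]
    simp only [Matrix.of_apply, Finset.sum_apply, Matrix.sum_apply]
  calc k * m * n
      = (Matrix.of fun (ρ : Fin k × (Fin m × Fin n)) (c : Fin m × (Fin k × Fin n)) =>
          matMulTensor ℂ k m n c.2 (ρ.1, c.1) ρ.2).rank := (rank_xFlattening_matMulTensor k m n).symm
    _ = (∑ i, Matrix.of fun (ρ : Fin k × (Fin m × Fin n)) (c : Fin m × (Fin k × Fin n)) =>
          triad (w i) (u i) (v i) c.2 (ρ.1, c.1) ρ.2).rank := by rw [hflat]
    _ ≤ ∑ i, (Matrix.of fun (ρ : Fin k × (Fin m × Fin n)) (c : Fin m × (Fin k × Fin n)) =>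
          triad (w i) (u i) (v i) c.2 (ρ.1, c.1) ρ.2).rank := rank_sum_le _ _
    _ ≤ ∑ i, (Matrix.of fun p q => u i (p, q)).rank :=
        Finset.sum_le_sum fun i _ => rank_xFlattening_triad_le (w i) (u i) (v i)

end Summit.MatrixMultiplication.MatrixMultiplication.Theorems
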